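import Summits.KontsevichZagierPeriods.KontsevichZagierPeriods.Theses.HyperbolicBloch
import Summits.KontsevichZagierPeriods.KontsevichZagierPeriods.Theorems.HyperbolicBlochIsometryMoveSimilarity
import Summits.KontsevichZagierPeriods.KontsevichZagierPeriods.Theorems.HyperbolicBlochIsometryMoveInversion
import Summits.KontsevichZagierPeriods.KontsevichZagierPeriods.Theorems.HyperbolicBlochIsometryMoveTransport
import Summits.KontsevichZagierPeriods.KontsevichZagierPeriods.Theorems.HyperbolicBlochIsometryMoveFactorisation
import Summits.KontsevichZagierPeriods.KontsevichZagierPeriods.Theorems.HyperbolicBlochIsometryMoveAffineCase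

/-!
# `IsometryMove` (stmt-KontsevichZagierPeriods-3471, route HyperbolicBloch) — line `bruhat-inversion-chain`

The crux: for algebraic `a b c d : ℂ` with `ad − bc ≠ 0` and `ε = ±1`, the Poincaré extension
`g(w, t) = (((aw+b)·conj(cw+d) + a·conj(c)·t²)/N, ‖ad−bc‖·t/N)`, `N = |cw+d|² + |c|²t²`, `w = x + iεy`,
transports every KZ integral representation `[σ, t⁻³]` (`σ ⊆ {t > 0}`) to an EQUIVALENT representation
`[g σ, t⁻³]`.

Line (Bruhat cells `B ∪ BwB` of `PSL₂(ℂ)` read in `ℍ³`; Benedetti–Petronio 1992, proof of Prop. A.3.5(2)):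
* `c = 0`: `g` is ONE boundary-fixing similarity `S(α, β, η) : (x, y, t) ↦ (α(x + iηy) + β, ‖α‖ t)` with
  `α = a/d`, `β = b/d`, `η = ε` (`stub_affineCase`), and a similarity with algebraic `α ≠ 0`, `β` and
  `η = ±1` is ONE `KZ.changeOfVariablesRel` move (`stub_similarityMove` + `stub_moveTransport`:
  `|det DS| = ‖α‖³ = (S₃/t)³`);
* `c ≠ 0`: `g = S(−(ad−bc)/c, a/c, 1) ∘ J ∘ S(c, d, ε)` pointwise on `{t > 0}` (`stub_bruhatFactorisation`),
  where `J(p) = (p₀, −p₁, p₂)/|p|²` is the unit inversion composed with the mirror (the Poincaré extension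
  of `w ↦ 1/w`; `|det DJ| = |p|⁻⁶ = (J₃/t)³`, `stub_inversionMove`); each factor is one move between
  successive image representations (`stub_moveTransport` builds `[Φ σ, t⁻³]` — `ℚ`-semialgebraic image
  by Tarski–Seidenberg, integrability of `t⁻³` on the image by the change-of-variables formula — and gives
  the move), and `KZ.Equivalent` is transitive.

References: R. Benedetti, C. Petronio, *Lectures on Hyperbolic Geometry* (1992), A.3.5, A.4.2–A.4.4;
M. Kontsevich, D. Zagier, *Periods* (2001), §1.2 rule (2); J. Bochnak, M. Coste, M.-F. Roy,
*Real Algebraic Geometry* (1998), Prop. 2.2.6–2.2.7.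
-/

noncomputable section

open Set MeasureTheory
open Literature.NumberTheory.Transcendental Literature.ModelTheory.ExponentialFields

namespace Summit.KontsevichZagierPeriods.HyperbolicBloch.IsometryMove

/-! ## The five stubs of the line

All five are LANDED helper files (`--supports stmt-KontsevichZagierPeriods-3471`) in this namespace and are
imported above: `stub_similarityMove` (`…Similarity.lean`), `stub_inversionMove` (`…Inversion.lean`),
`stub_moveTransport` (`…Transport.lean`), `stub_bruhatFactorisation` (`…Factorisation.lean`),
`stub_affineCase` (`…AffineCase.lean`). -/

/-! ## Composition: the stubs imply the crux

No definitions are introduced: the similarities `S(α, β, η) p = ((α(p₀ + iηp₁) + β).re, (…).im, ‖α‖p₂)` and the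
inversion `J` enter the lemmas below as functions with a defining hypothesis, exactly as `g` enters the crux. -/

/-- One similarity move, in transport form: from `[σ, t⁻³]` (`σ ⊆ {t > 0}`) to an image representation
`[S σ, t⁻³]`, and to any given representation on `S σ` with integrand `t⁻³`.
[cite: KontsevichZagier2001, §1.2 rule (2)] -/
theorem simil_transport {α β : ℂ} {η : ℝ} (hα : IsAlgebraic ℚ α) (hβ : IsAlgebraic ℚ β) (h0 : α ≠ 0)
    (hη : η = 1 ∨ η = -1) (S : (Fin 3 → ℝ) → (Fin 3 → ℝ))
    (hS : ∀ p, S p = ![(α * (Complex.mk (p 0) (η * p 1)) + β).re, (α * (Complex.mk (p 0) (η * p 1)) + β).im,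
      ‖α‖ * p 2])
    (r : KZ.IntegralRep 3) (hσ : r.domain ⊆ {p | 0 < p 2})
    (hint : EqOn r.integrand (fun p => 1 / p 2 ^ 3) r.domain) :
    (∃ r₁ : KZ.IntegralRep 3, r₁.domain = S '' r.domain ∧
        EqOn r₁.integrand (fun p => 1 / p 2 ^ 3) r₁.domain) ∧
      (∀ r' : KZ.IntegralRep 3, r'.domain = S '' r.domain →
        EqOn r'.integrand (fun p => 1 / p 2 ^ 3) r'.domain → KZ.Equivalent r r') := by
  obtain ⟨hS', hinj, hmaps, hderiv⟩ := stub_similarityMove α β η hα hβ h0 hη S hS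
    r.domain r.isSemialgebraic_domain hσ
  exact stub_moveTransport S r hσ hint hS' hinj hmaps hderiv

/-- One inversion move, in transport form. [cite: KontsevichZagier2001, §1.2 rule (2)] -/
theorem inversion_transport (J : (Fin 3 → ℝ) → (Fin 3 → ℝ))
    (hJ : ∀ p, J p = ![p 0 / (p 0 ^ 2 + p 1 ^ 2 + p 2 ^ 2), -p 1 / (p 0 ^ 2 + p 1 ^ 2 + p 2 ^ 2),
      p 2 / (p 0 ^ 2 + p 1 ^ 2 + p 2 ^ 2)])
    (r : KZ.IntegralRep 3) (hσ : r.domain ⊆ {p | 0 < p 2})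
    (hint : EqOn r.integrand (fun p => 1 / p 2 ^ 3) r.domain) :
    (∃ r₁ : KZ.IntegralRep 3, r₁.domain = J '' r.domain ∧
        EqOn r₁.integrand (fun p => 1 / p 2 ^ 3) r₁.domain) ∧
      (∀ r' : KZ.IntegralRep 3, r'.domain = J '' r.domain →
        EqOn r'.integrand (fun p => 1 / p 2 ^ 3) r'.domain → KZ.Equivalent r r') := by
  obtain ⟨hS', hinj, hmaps, hderiv⟩ := stub_inversionMove J hJ r.domain r.isSemialgebraic_domain hσ
  exact stub_moveTransport J r hσ hint hS' hinj hmaps hderiv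

/-- Images of subsets of `{t > 0}` under a similarity with `α ≠ 0` stay in `{t > 0}`. [folklore] -/
theorem simil_image_subset {α β : ℂ} {η : ℝ} (h0 : α ≠ 0) (S : (Fin 3 → ℝ) → (Fin 3 → ℝ))
    (hS : ∀ p, S p = ![(α * (Complex.mk (p 0) (η * p 1)) + β).re, (α * (Complex.mk (p 0) (η * p 1)) + β).im,
      ‖α‖ * p 2])
    {σ : Set (Fin 3 → ℝ)} (hσ : σ ⊆ {p | 0 < p 2}) : S '' σ ⊆ {p | 0 < p 2} := by
  rintro _ ⟨p, hp, rfl⟩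
  have hp2 : 0 < p 2 := hσ hp
  show 0 < S p 2
  simp only [hS, Matrix.cons_val_two, Matrix.tail_cons, Matrix.head_cons]
  exact mul_pos (norm_pos_iff.mpr h0) hp2

/-- Images of subsets of `{t > 0}` under the inversion stay in `{t > 0}`. [folklore] -/
theorem inversion_image_subset (J : (Fin 3 → ℝ) → (Fin 3 → ℝ))
    (hJ : ∀ p, J p = ![p 0 / (p 0 ^ 2 + p 1 ^ 2 + p 2 ^ 2), -p 1 / (p 0 ^ 2 + p 1 ^ 2 + p 2 ^ 2),
      p 2 / (p 0 ^ 2 + p 1 ^ 2 + p 2 ^ 2)])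
    {σ : Set (Fin 3 → ℝ)} (hσ : σ ⊆ {p | 0 < p 2}) : J '' σ ⊆ {p | 0 < p 2} := by
  rintro _ ⟨p, hp, rfl⟩
  have hp2 : 0 < p 2 := hσ hp
  show 0 < J p 2
  simp only [hJ, Matrix.cons_val_two, Matrix.tail_cons, Matrix.head_cons]
  exact div_pos hp2 (by positivity)

/-- **The crux `IsometryMove` from the stubs of line `bruhat-inversion-chain`**: `c = 0` — one similarity move
(`stub_affineCase`); `c ≠ 0` — `r ∼ [S₁σ] ∼ [J S₁σ] ∼ r'` by three moves (`stub_bruhatFactorisation`),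
chained by `KZ.Equivalent.trans`. [cite: BenedettiPetronio1992, A.3.5] -/
theorem isometryMove_proof :
    Summit.KontsevichZagierPeriods.KontsevichZagierPeriods.Theses.HyperbolicBloch.IsometryMove := by
  intro a b c d ε ha hb hc hd hdet hε g hg r r' hσ hint hdom hint'
  -- the three elementary maps, as functions with defining equations
  obtain ⟨J, hJ⟩ : ∃ J : (Fin 3 → ℝ) → (Fin 3 → ℝ), ∀ p, J p = ![p 0 / (p 0 ^ 2 + p 1 ^ 2 + p 2 ^ 2),
      -p 1 / (p 0 ^ 2 + p 1 ^ 2 + p 2 ^ 2), p 2 / (p 0 ^ 2 + p 1 ^ 2 + p 2 ^ 2)] := ⟨_, fun _ => rfl⟩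
  have hSim : ∀ (α β : ℂ) (η : ℝ), ∃ S : (Fin 3 → ℝ) → (Fin 3 → ℝ), ∀ p, S p =
      ![(α * (Complex.mk (p 0) (η * p 1)) + β).re, (α * (Complex.mk (p 0) (η * p 1)) + β).im, ‖α‖ * p 2] :=
    fun α β η => ⟨_, fun _ => rfl⟩
  by_cases hc0 : c = 0
  · -- small Bruhat cell: one similarity move
    have hd0 : d ≠ 0 := by
      rintro rfl
      apply hdet
      simp [hc0]
    have hα : IsAlgebraic ℚ (a / d) := by simpa [div_eq_mul_inv] using ha.mul hd.inv
    have hβ : IsAlgebraic ℚ (b / d) := by simpa [div_eq_mul_inv] using hb.mul hd.inv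
    have hα0 : a / d ≠ 0 := by
      refine div_ne_zero ?_ hd0
      rintro rfl
      apply hdet
      simp [hc0]
    obtain ⟨S, hS⟩ := hSim (a / d) (b / d) ε
    have hgS : EqOn g S r.domain := fun p _ => by
      rw [hg p]
      exact stub_affineCase a b c d ε hc0 hd0 S hS p
    have hdom' : r'.domain = S '' r.domain := by
      rw [hdom]
      exact image_congr hgS
    exact (simil_transport hα hβ hα0 hε S hS r hσ hint).2 r' hdom' hint'
  · -- big Bruhat cell: similarity, inversion, similarity
    have hα₂ : IsAlgebraic ℚ (-(a * d - b * c) / c) := by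
      have hKalg : IsAlgebraic ℚ (a * d - b * c) := (ha.mul hd).sub (hb.mul hc)
      simpa [div_eq_mul_inv] using hKalg.neg.mul hc.inv
    have hβ₂ : IsAlgebraic ℚ (a / c) := by simpa [div_eq_mul_inv] using ha.mul hc.inv
    have hα₂0 : -(a * d - b * c) / c ≠ 0 := div_ne_zero (neg_ne_zero.mpr hdet) hc0
    obtain ⟨S₁, hS₁⟩ := hSim c d ε
    obtain ⟨S₂, hS₂⟩ := hSim (-(a * d - b * c) / c) (a / c) 1
    -- first move: `S₁ = S(c, d, ε)`
    obtain ⟨⟨r₁, hr₁dom, hr₁int⟩, hmove₁⟩ := simil_transport hc hd hc0 hε S₁ hS₁ r hσ hint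
    have hσ₁ : r₁.domain ⊆ {p | 0 < p 2} := hr₁dom ▸ simil_image_subset hc0 S₁ hS₁ hσ
    have h₁ : KZ.Equivalent r r₁ := hmove₁ r₁ hr₁dom hr₁int
    -- second move: the inversion
    obtain ⟨⟨r₂, hr₂dom, hr₂int⟩, hmove₂⟩ := inversion_transport J hJ r₁ hσ₁ hr₁int
    have hσ₂ : r₂.domain ⊆ {p | 0 < p 2} := hr₂dom ▸ inversion_image_subset J hJ hσ₁
    have h₂ : KZ.Equivalent r₁ r₂ := hmove₂ r₂ hr₂dom hr₂int
    -- third move: `S₂ = S(−(ad−bc)/c, a/c, 1)`, landing on the GIVEN `r'`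
    have hgS : EqOn g (S₂ ∘ J ∘ S₁) r.domain := fun p hp => by
      rw [hg p]
      exact stub_bruhatFactorisation a b c d ε hc0 S₁ J S₂ hS₁ hJ hS₂ p (hσ hp)
    have hdom' : r'.domain = S₂ '' r₂.domain := by
      rw [hdom, image_congr hgS, hr₂dom, hr₁dom, image_image, image_image]
      rfl
    have h₃ : KZ.Equivalent r₂ r' := (simil_transport hα₂ hβ₂ hα₂0 (Or.inl rfl) S₂ hS₂ r₂ hσ₂ hr₂int).2
      r' hdom' hint'
    exact (h₁.trans h₂).trans h₃

end Summit.KontsevichZagierPeriods.HyperbolicBloch.IsometryMove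

end
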